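import Literature.Computability.QuantumComplexity.CoreDescSLPCodes
import HarnessLib

/-!
# The register compiler on codes for parametric expressions with truncated-affine leaves

Topic `Literature/Computability/QuantumComplexity`; a sibling of `CoreDescSLPCodes.lean` (§ "parametric expressions",
`AJLCore.PA/PB`, affine leaves `(a, b) ↦ a·k + b`) for the UNIFORMITY of Regev's sampler ([Regev2009, Lemma 3.14, proof];
Arora–Barak §6.2): the Grover–Rudolph level program `SLP.grLevelB k 0` (`GRPredicates.lean`) has the leaves `2^{k−1}`,
`2^{2(k−1)}` of `SLP.sOffB`, which are NOT affine in `k` but are TRUNCATED-affine, `(a, b, c) ↦ a·k + b − c`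
(`k − 1 = 1·k + 0 − 1`, `2(k − 1) = 2·k + 0 − 2`). We copy the parametric expressions with such leaves — `PA3`/`PB3`,
instances `PA3.inst k`/`PB3.inst k` — and the structural-induction proof that the compiler `SLP.AExpr.compile` /
`SLP.BExpr.compile` runs in polynomial time on them, verbatim from `AJLCore.PA.codeFP`/`AJLCore.PB.codeFP` with the leaf
computation `affUn3`/`affNat3` (`1ᵏ ↦ 1^{a·k+b−c}` by truncated subtraction on codes):

* `AJLCore.Aff3`, `Aff3.ev`, `affUn3`, `affNat3`; `PA3`, `PB3`, `PA3.inst`, `PB3.inst`;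
* **`AJLCore.PA3.codeFP`**, **`AJLCore.PB3.codeFP pb : CodeFP inBE outBE (fun t => (pb.inst t.1).compile (thrWd t.1) t.2.1 t.2.2)`**;
* `AJLCore.compile_inst_codeFP3 pb : CodeFP unE outBE (fun k => (pb.inst k).compile (thrWd k) 0 0)`;
* the embedding `Aff.toAff3`, `PA.toPA3`, `PB.toPB3` with `inst_toPA3`, `inst_toPB3` (every affine program is one).

USE (successor of the Regev line): write the `PB3` mirror `grLevelPB3 : PB3` of `SLP.grLevelB k 0` (as `inst_bRotPB` does for
the AJL letters), then `compile_inst_codeFP3 grLevelPB3` is the compiler output `(GRWord.prog k).compile (thrWd k) 0 0` on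
codes, the input of `GP.gopsA_fp` / `GenKit.gR/gF/gT` (`GenKitFP.lean`, `GenKit.lean`).

Everything is proved; no named fact is introduced.

## References

* O. Regev, J. ACM 56(6) (2009), Lemma 3.14 (proof) [Regev2009].
* S. Arora, B. Barak, *Computational Complexity: A Modern Approach*, CUP 2009, §1.3 and §6.2 [AroraBarak2009].
* D. Aharonov, V. Jones, Z. Landau, Algorithmica 55 (2009), §3.3 [AharonovJonesLandau2009].
-/

noncomputable section

namespace Literature.Computability.QuantumComplexity

open _root_.Computability Complexity Complexity.CodeFP SLP

namespace AJLCore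

/-! ### Truncated-affine leaves -/

/-- A truncated-affine function `k ↦ a·k + b − c` of the parameter, as data. [folklore] -/
abbrev Aff3 : Type := ℕ × ℕ × ℕ

/-- Its value. [folklore] -/
def Aff3.ev (f : Aff3) (k : ℕ) : ℕ := f.1 * k + f.2.1 - f.2.2

/-- `1ᵏ ↦ 1^{a·k + b − c}`. [folklore] -/
theorem affUn3 (f : Aff3) : CodeFP unE unE f.ev :=
  (unOfNatMin.comp ((affUn f.1 f.2.1).pair (natSub.comp ((natOfUn.comp (affUn f.1 f.2.1)).pair (const unE f.2.2))))).congr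
    fun k => by show min (id (f.1 * k + f.2.1) - f.2.2) (f.1 * k + f.2.1) = f.ev k; rw [Aff3.ev, id]; omega

/-- `1ᵏ ↦ bin (a·k + b − c)`. [folklore] -/
theorem affNat3 (f : Aff3) : CodeFP unE natE f.ev := (natOfUn.comp (affUn3 f)).congr fun _ => rfl

/-! ### Parametric expressions with truncated-affine leaves -/

/-- Parametric arithmetic expressions: `SLP.AExpr` with truncated-affine leaves. [folklore] -/
inductive PA3
  /-- the input field -/
  | fld (off len : Aff3)
  /-- the constant `2^i` -/
  | pw (i : Aff3)
  /-- `e₁ + e₂·2^sh` -/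
  | add (e₁ e₂ : PA3) (sh : Aff3)
  /-- `e₁·e₂` -/
  | mul (e₁ e₂ : PA3)

/-- Parametric Boolean expressions with truncated-affine leaves. [folklore] -/
inductive PB3
  /-- `e₁ < e₂` -/
  | lt (e₁ e₂ : PA3)
  /-- negation -/
  | not (b : PB3)
  /-- conjunction -/
  | and (b₁ b₂ : PB3)
  /-- disjunction -/
  | or (b₁ b₂ : PB3)

/-- The instance of a truncated-affine parametric arithmetic expression at `k`. [folklore] -/
def PA3.inst (k : ℕ) : PA3 → AExpr
  | .fld off len => .fld (off.ev k) (len.ev k)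
  | .pw i => .pw (i.ev k)
  | .add e₁ e₂ sh => .add (e₁.inst k) (e₂.inst k) (sh.ev k)
  | .mul e₁ e₂ => .mul (e₁.inst k) (e₂.inst k)

/-- The instance of a truncated-affine parametric Boolean expression at `k`. [folklore] -/
def PB3.inst (k : ℕ) : PB3 → BExpr
  | .lt e₁ e₂ => .lt (e₁.inst k) (e₂.inst k)
  | .not b => .not (b.inst k)
  | .and b₁ b₂ => .and (b₁.inst k) (b₂.inst k)
  | .or b₁ b₂ => .or (b₁.inst k) (b₂.inst k)

/-! ### The compiler on truncated-affine parametric expressions (verbatim `PA.codeFP` / `PB.codeFP`) -/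

/-- **The arithmetic compiler in polynomial time** on truncated-affine expressions: `(1ᵏ, 1ʳ) ↦ (pe.inst k).compile (4k+16) r`.
[cite: AroraBarak2009, §1.3] -/
theorem PA3.codeFP : ∀ pe : PA3, CodeFP inAE outAE (fun t => (pe.inst t.1).compile (thrWd t.1) t.2)
  | .fld off len => by
    have h : CodeFP inAE outAE (fun t => ([Instr.copyIn t.2 (off.ev t.1) (len.ev t.1)], t.2, t.2 + 1)) := (
      ((rawSingleton instrE).comp (instr_copyIn (natOfUn.comp (snd _ _)) ((affNat3 off).comp (fst _ _)) ((affUn3 len).comp (fst _ _)))).pair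
        ((snd _ _).pair (unSucc.comp (snd _ _))) :)
    exact h.congr fun t => rfl
  | .pw i => by
    have h : CodeFP inAE outAE (fun t => ([Instr.setBit t.2 (i.ev t.1)], t.2, t.2 + 1)) := (
      ((rawSingleton instrE).comp (instr_setBit (natOfUn.comp (snd _ _)) ((affNat3 i).comp (fst _ _)))).pair ((snd _ _).pair (unSucc.comp (snd _ _))) :)
    exact h.congr fun t => rfl
  | .add e₁ e₂ sh => by
    have H1 : CodeFP inAE outAE (fun t => (e₁.inst t.1).compile (thrWd t.1) t.2) := (PA3.codeFP e₁ :)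
    have H2 : CodeFP inAE outAE (fun t => (e₂.inst t.1).compile (thrWd t.1) ((e₁.inst t.1).compile (thrWd t.1) t.2).2.2) := (
      (PA3.codeFP e₂).comp ((fst _ _).pair H1.snd'.snd') :)
    have h : CodeFP inAE outAE (fun t =>
        (((e₁.inst t.1).compile (thrWd t.1) t.2).1 ++ ((e₂.inst t.1).compile (thrWd t.1) ((e₁.inst t.1).compile (thrWd t.1) t.2).2.2).1 ++
          [Instr.add ((e₂.inst t.1).compile (thrWd t.1) ((e₁.inst t.1).compile (thrWd t.1) t.2).2.2).2.2 ((e₁.inst t.1).compile (thrWd t.1) t.2).2.1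
            ((e₂.inst t.1).compile (thrWd t.1) ((e₁.inst t.1).compile (thrWd t.1) t.2).2.2).2.1 (sh.ev t.1)],
        ((e₂.inst t.1).compile (thrWd t.1) ((e₁.inst t.1).compile (thrWd t.1) t.2).2.2).2.2,
        ((e₂.inst t.1).compile (thrWd t.1) ((e₁.inst t.1).compile (thrWd t.1) t.2).2.2).2.2 + 1)) := (
      ((rawAppend instrE).comp (((rawAppend instrE).comp (H1.fst'.pair H2.fst')).pair ((rawSingleton instrE).comp
        (instr_add (natOfUn.comp H2.snd'.snd') (natOfUn.comp H1.snd'.fst') (natOfUn.comp H2.snd'.fst') ((affNat3 sh).comp (fst _ _)))))).pair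
        (H2.snd'.snd'.pair (unSucc.comp H2.snd'.snd')) :)
    exact h.congr fun t => rfl
  | .mul e₁ e₂ => by
    have H1 : CodeFP inAE outAE (fun t => (e₁.inst t.1).compile (thrWd t.1) t.2) := (PA3.codeFP e₁ :)
    have H2 : CodeFP inAE outAE (fun t => (e₂.inst t.1).compile (thrWd t.1) ((e₁.inst t.1).compile (thrWd t.1) t.2).2.2) := (
      (PA3.codeFP e₂).comp ((fst _ _).pair H1.snd'.snd') :)
    have hW : CodeFP inAE unE (fun t => 2 * thrWd t.1) := ((affUn 8 32).comp (fst _ _)).congr fun t => by simp [thrWd]; ring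
    have h : CodeFP inAE outAE (fun t =>
        (((e₁.inst t.1).compile (thrWd t.1) t.2).1 ++ ((e₂.inst t.1).compile (thrWd t.1) ((e₁.inst t.1).compile (thrWd t.1) t.2).2.2).1 ++
          mulInstrs (thrWd t.1) ((e₂.inst t.1).compile (thrWd t.1) ((e₁.inst t.1).compile (thrWd t.1) t.2).2.2).2.2 ((e₁.inst t.1).compile (thrWd t.1) t.2).2.1
            ((e₂.inst t.1).compile (thrWd t.1) ((e₁.inst t.1).compile (thrWd t.1) t.2).2.2).2.1,
        ((e₂.inst t.1).compile (thrWd t.1) ((e₁.inst t.1).compile (thrWd t.1) t.2).2.2).2.2 + 2 * thrWd t.1,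
        ((e₂.inst t.1).compile (thrWd t.1) ((e₁.inst t.1).compile (thrWd t.1) t.2).2.2).2.2 + 2 * thrWd t.1 + 1)) := (
      ((rawAppend instrE).comp (((rawAppend instrE).comp (H1.fst'.pair H2.fst')).pair
        (mulInstrs_codeFP.comp ((fst _ _).pair ((natOfUn.comp H2.snd'.snd').pair ((natOfUn.comp H1.snd'.fst').pair (natOfUn.comp H2.snd'.fst'))))))).pair
        ((unAdd.comp (H2.snd'.snd'.pair hW)).pair (unSucc.comp (unAdd.comp (H2.snd'.snd'.pair hW)))) :)
    exact h.congr fun t => rfl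

/-- **The Boolean compiler in polynomial time** on truncated-affine expressions: `(1ᵏ, 1ʳ, 1ᵠ) ↦ (pb.inst k).compile (4k+16) r φ`.
[cite: AroraBarak2009, §1.3] [cite: Regev2009, Lemma 3.14 (proof)] -/
theorem PB3.codeFP : ∀ pb : PB3, CodeFP inBE outBE (fun t => (pb.inst t.1).compile (thrWd t.1) t.2.1 t.2.2)
  | .lt e₁ e₂ => by
    have H1 : CodeFP inBE outAE (fun t => (e₁.inst t.1).compile (thrWd t.1) t.2.1) := ((PA3.codeFP e₁).comp ((fst _ _).pair (snd _ _).fst') :)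
    have H2 : CodeFP inBE outAE (fun t => (e₂.inst t.1).compile (thrWd t.1) ((e₁.inst t.1).compile (thrWd t.1) t.2.1).2.2) := (
      (PA3.codeFP e₂).comp ((fst _ _).pair H1.snd'.snd') :)
    have hφ : CodeFP inBE unE (fun t => t.2.2) := ((snd _ _).snd' :)
    have h : CodeFP inBE outBE (fun t =>
        (((e₁.inst t.1).compile (thrWd t.1) t.2.1).1 ++ ((e₂.inst t.1).compile (thrWd t.1) ((e₁.inst t.1).compile (thrWd t.1) t.2.1).2.2).1 ++
          [Instr.lt t.2.2 ((e₁.inst t.1).compile (thrWd t.1) t.2.1).2.1 ((e₂.inst t.1).compile (thrWd t.1) ((e₁.inst t.1).compile (thrWd t.1) t.2.1).2.2).2.1],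
        t.2.2, ((e₂.inst t.1).compile (thrWd t.1) ((e₁.inst t.1).compile (thrWd t.1) t.2.1).2.2).2.2, t.2.2 + 1)) := (
      ((rawAppend instrE).comp (((rawAppend instrE).comp (H1.fst'.pair H2.fst')).pair ((rawSingleton instrE).comp
        (instr_lt (natOfUn.comp hφ) (natOfUn.comp H1.snd'.fst') (natOfUn.comp H2.snd'.fst'))))).pair (hφ.pair (H2.snd'.snd'.pair (unSucc.comp hφ))) :)
    exact h.congr fun t => rfl
  | .not b => by
    have H : CodeFP inBE outBE (fun t => (b.inst t.1).compile (thrWd t.1) t.2.1 t.2.2) := (PB3.codeFP b :)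
    have h : CodeFP inBE outBE (fun t =>
        (((b.inst t.1).compile (thrWd t.1) t.2.1 t.2.2).1 ++ [Instr.fnot ((b.inst t.1).compile (thrWd t.1) t.2.1 t.2.2).2.2.2 ((b.inst t.1).compile (thrWd t.1) t.2.1 t.2.2).2.1],
        ((b.inst t.1).compile (thrWd t.1) t.2.1 t.2.2).2.2.2, ((b.inst t.1).compile (thrWd t.1) t.2.1 t.2.2).2.2.1, ((b.inst t.1).compile (thrWd t.1) t.2.1 t.2.2).2.2.2 + 1)) := (
      ((rawAppend instrE).comp (H.fst'.pair ((rawSingleton instrE).comp (instr_fnot (natOfUn.comp H.snd'.snd'.snd') (natOfUn.comp H.snd'.fst'))))).pair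
        (H.snd'.snd'.snd'.pair (H.snd'.snd'.fst'.pair (unSucc.comp H.snd'.snd'.snd'))) :)
    exact h.congr fun t => rfl
  | .and b₁ b₂ => by
    have H1 : CodeFP inBE outBE (fun t => (b₁.inst t.1).compile (thrWd t.1) t.2.1 t.2.2) := (PB3.codeFP b₁ :)
    have H2 : CodeFP inBE outBE (fun t => (b₂.inst t.1).compile (thrWd t.1) ((b₁.inst t.1).compile (thrWd t.1) t.2.1 t.2.2).2.2.1 ((b₁.inst t.1).compile (thrWd t.1) t.2.1 t.2.2).2.2.2) := (
      (PB3.codeFP b₂).comp ((fst _ _).pair (H1.snd'.snd'.fst'.pair H1.snd'.snd'.snd')) :)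
    have h : CodeFP inBE outBE (fun t =>
        (((b₁.inst t.1).compile (thrWd t.1) t.2.1 t.2.2).1 ++ ((b₂.inst t.1).compile (thrWd t.1) ((b₁.inst t.1).compile (thrWd t.1) t.2.1 t.2.2).2.2.1 ((b₁.inst t.1).compile (thrWd t.1) t.2.1 t.2.2).2.2.2).1 ++
          [Instr.fand ((b₂.inst t.1).compile (thrWd t.1) ((b₁.inst t.1).compile (thrWd t.1) t.2.1 t.2.2).2.2.1 ((b₁.inst t.1).compile (thrWd t.1) t.2.1 t.2.2).2.2.2).2.2.2
            ((b₁.inst t.1).compile (thrWd t.1) t.2.1 t.2.2).2.1 ((b₂.inst t.1).compile (thrWd t.1) ((b₁.inst t.1).compile (thrWd t.1) t.2.1 t.2.2).2.2.1 ((b₁.inst t.1).compile (thrWd t.1) t.2.1 t.2.2).2.2.2).2.1],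
        ((b₂.inst t.1).compile (thrWd t.1) ((b₁.inst t.1).compile (thrWd t.1) t.2.1 t.2.2).2.2.1 ((b₁.inst t.1).compile (thrWd t.1) t.2.1 t.2.2).2.2.2).2.2.2,
        ((b₂.inst t.1).compile (thrWd t.1) ((b₁.inst t.1).compile (thrWd t.1) t.2.1 t.2.2).2.2.1 ((b₁.inst t.1).compile (thrWd t.1) t.2.1 t.2.2).2.2.2).2.2.1,
        ((b₂.inst t.1).compile (thrWd t.1) ((b₁.inst t.1).compile (thrWd t.1) t.2.1 t.2.2).2.2.1 ((b₁.inst t.1).compile (thrWd t.1) t.2.1 t.2.2).2.2.2).2.2.2 + 1)) := (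
      ((rawAppend instrE).comp (((rawAppend instrE).comp (H1.fst'.pair H2.fst')).pair ((rawSingleton instrE).comp
        (instr_fand (natOfUn.comp H2.snd'.snd'.snd') (natOfUn.comp H1.snd'.fst') (natOfUn.comp H2.snd'.fst'))))).pair
        (H2.snd'.snd'.snd'.pair (H2.snd'.snd'.fst'.pair (unSucc.comp H2.snd'.snd'.snd'))) :)
    exact h.congr fun t => rfl
  | .or b₁ b₂ => by
    have H1 : CodeFP inBE outBE (fun t => (b₁.inst t.1).compile (thrWd t.1) t.2.1 t.2.2) := (PB3.codeFP b₁ :)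
    have H2 : CodeFP inBE outBE (fun t => (b₂.inst t.1).compile (thrWd t.1) ((b₁.inst t.1).compile (thrWd t.1) t.2.1 t.2.2).2.2.1 ((b₁.inst t.1).compile (thrWd t.1) t.2.1 t.2.2).2.2.2) := (
      (PB3.codeFP b₂).comp ((fst _ _).pair (H1.snd'.snd'.fst'.pair H1.snd'.snd'.snd')) :)
    have h : CodeFP inBE outBE (fun t =>
        (((b₁.inst t.1).compile (thrWd t.1) t.2.1 t.2.2).1 ++ ((b₂.inst t.1).compile (thrWd t.1) ((b₁.inst t.1).compile (thrWd t.1) t.2.1 t.2.2).2.2.1 ((b₁.inst t.1).compile (thrWd t.1) t.2.1 t.2.2).2.2.2).1 ++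
          [Instr.forr ((b₂.inst t.1).compile (thrWd t.1) ((b₁.inst t.1).compile (thrWd t.1) t.2.1 t.2.2).2.2.1 ((b₁.inst t.1).compile (thrWd t.1) t.2.1 t.2.2).2.2.2).2.2.2
            ((b₁.inst t.1).compile (thrWd t.1) t.2.1 t.2.2).2.1 ((b₂.inst t.1).compile (thrWd t.1) ((b₁.inst t.1).compile (thrWd t.1) t.2.1 t.2.2).2.2.1 ((b₁.inst t.1).compile (thrWd t.1) t.2.1 t.2.2).2.2.2).2.1],
        ((b₂.inst t.1).compile (thrWd t.1) ((b₁.inst t.1).compile (thrWd t.1) t.2.1 t.2.2).2.2.1 ((b₁.inst t.1).compile (thrWd t.1) t.2.1 t.2.2).2.2.2).2.2.2,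
        ((b₂.inst t.1).compile (thrWd t.1) ((b₁.inst t.1).compile (thrWd t.1) t.2.1 t.2.2).2.2.1 ((b₁.inst t.1).compile (thrWd t.1) t.2.1 t.2.2).2.2.2).2.2.1,
        ((b₂.inst t.1).compile (thrWd t.1) ((b₁.inst t.1).compile (thrWd t.1) t.2.1 t.2.2).2.2.1 ((b₁.inst t.1).compile (thrWd t.1) t.2.1 t.2.2).2.2.2).2.2.2 + 1)) := (
      ((rawAppend instrE).comp (((rawAppend instrE).comp (H1.fst'.pair H2.fst')).pair ((rawSingleton instrE).comp
        (instr_forr (natOfUn.comp H2.snd'.snd'.snd') (natOfUn.comp H1.snd'.fst') (natOfUn.comp H2.snd'.fst'))))).pair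
        (H2.snd'.snd'.snd'.pair (H2.snd'.snd'.fst'.pair (unSucc.comp H2.snd'.snd'.snd'))) :)
    exact h.congr fun t => rfl

/-- The compiler output of one parametric program at `r = φ = 0`, from `1ᵏ`. [folklore] -/
theorem compile_inst_codeFP3 (pb : PB3) : CodeFP unE outBE (fun k => (pb.inst k).compile (thrWd k) 0 0) :=
  ((PB3.codeFP pb).comp ((CodeFP.id unE).pair ((const unE 0).pair (const unE 0)))).congr fun _ => rfl

/-! ### Affine programs are truncated-affine programs -/

/-- The embedding of affine leaves. [folklore] -/
def Aff.toAff3 (f : Aff) : Aff3 := (f.1, f.2, 0)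

/-- Values are preserved. [folklore] -/
@[simp] theorem Aff.ev_toAff3 (f : Aff) (k : ℕ) : f.toAff3.ev k = f.ev k := by simp [Aff.toAff3, Aff3.ev, Aff.ev]

/-- The embedding of parametric arithmetic expressions. [folklore] -/
def PA.toPA3 : PA → PA3
  | .fld off len => .fld off.toAff3 len.toAff3
  | .pw i => .pw i.toAff3
  | .add e₁ e₂ sh => .add e₁.toPA3 e₂.toPA3 sh.toAff3
  | .mul e₁ e₂ => .mul e₁.toPA3 e₂.toPA3

/-- The embedding of parametric Boolean expressions. [folklore] -/
def PB.toPB3 : PB → PB3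
  | .lt e₁ e₂ => .lt e₁.toPA3 e₂.toPA3
  | .not b => .not b.toPB3
  | .and b₁ b₂ => .and b₁.toPB3 b₂.toPB3
  | .or b₁ b₂ => .or b₁.toPB3 b₂.toPB3

/-- Instances are preserved. [folklore] -/
theorem PA.inst_toPA3 (k : ℕ) : ∀ pe : PA, pe.toPA3.inst k = pe.inst k
  | .fld off len => by simp [PA.toPA3, PA3.inst, PA.inst]
  | .pw i => by simp [PA.toPA3, PA3.inst, PA.inst]
  | .add e₁ e₂ sh => by simp [PA.toPA3, PA3.inst, PA.inst, PA.inst_toPA3 k e₁, PA.inst_toPA3 k e₂]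
  | .mul e₁ e₂ => by simp [PA.toPA3, PA3.inst, PA.inst, PA.inst_toPA3 k e₁, PA.inst_toPA3 k e₂]

/-- Instances are preserved. [folklore] -/
theorem PB.inst_toPB3 (k : ℕ) : ∀ pb : PB, pb.toPB3.inst k = pb.inst k
  | .lt e₁ e₂ => by simp [PB.toPB3, PB3.inst, PB.inst, PA.inst_toPA3]
  | .not b => by simp [PB.toPB3, PB3.inst, PB.inst, PB.inst_toPB3 k b]
  | .and b₁ b₂ => by simp [PB.toPB3, PB3.inst, PB.inst, PB.inst_toPB3 k b₁, PB.inst_toPB3 k b₂]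
  | .or b₁ b₂ => by simp [PB.toPB3, PB3.inst, PB.inst, PB.inst_toPB3 k b₁, PB.inst_toPB3 k b₂]

end AJLCore

end Literature.Computability.QuantumComplexity

end
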